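import Summits.CriticalPhenomena.SAWScalingLimit.Theorems.SAWSpinMonotoneQCIdentificationNoCollapse
import Literature.Probability.LatticeModels.HexStarDirections

/-!
# `NoBranching`, step S2 — the interior hexagon: corner combinatorics and corner factors
(helper of `stub_noBranching : NoFoldBound → NoBranching`, line `eight_fifths_primitive`, crux
`QCIdentification`, stmt-CriticalPhenomena-16772; companion/auxiliary file of
`SAWSpinMonotoneQCIdentificationNoBranchingHexagon`, which proves the hexagon ledger itself)

**What.** Fix a site `x` of the triangular lattice `𝕋` and its six surrounding faces
`v_j = HexKernel.face x j` (`j : Fin 6`, counterclockwise, centres at angles `30° + 60° j` from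
`x`); the face `v_j` is the sector between the **spokes** `e_j = ζ^j` and `e_{j+1}` (`spoke`,
`ζ = e^{iπ/3}`). In the counterclockwise labelling `triVert`/`hexNbr` of the affine dictionary
(`SAWSpinMonotoneQCIdentificationAffineDictionary`), the corner of the triangle `Δ_{v_j}` AT `x` is
the one between the ports `k_j = cornerIdx j` and `k_j + 1` (`cornerIdx = ![1, 0, 2, 1, 0, 2]`,
`triVert_face_cornerIdx`): its outgoing edge is `+e_j` (`edge_out_eq_spoke`), its incoming edge is
`-e_{j+1}` (`edge_in_eq_neg_spoke`), the port `k_j` leads to `v_{j+1}` and the port `k_{j+1} + 1` of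
`v_{j+1}` leads back to `v_j` (`hexNbr_face_cornerIdx`, `hexNbr_face_succ`). For a mid-edge function
`F` this file proves:

* **darts across a shared mid-edge are opposite** (`s2_dart_shared_neg`, registered; pure
  geometry: the mid-edge point is the mean of the two centres), for every `F`;
* the **affine form of the darts** of the critical observable `F = Fobs Λ a` (`dart_affine`:
  `dart_k(v) = α(v) Δz_k + β(v) conj Δz_k`, the affine dictionary `Dev.affine` read through
  a potential, which exists by `Dev.exists_isPotential`);
* with the Beltrami quotient `μ(v) = β(v)/α(v)` (`mu`, `|μ| < 1` on non-degenerate faces under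
  the no-fold bound (K), `norm_mu_lt_one`) and the two **corner factors**
  `P_j = 1 + μ_j conj(e_j)/e_j`, `Q_j = 1 + μ_j conj(e_{j+1})/e_{j+1}` (`pfac`, `qfac`, both in
  the open right half-plane, `pfac_re_pos`, `qfac_re_pos`): the two darts of `v_j` at the corner
  are `α_j e_j P_j` and `-α_j e_{j+1} Q_j` (`dart_out_eq`, `dart_in_eq`), consecutive faces match
  across the shared spoke, `α_{j+1} P_{j+1} = α_j Q_j` (`alpha_succ_mul_pfac`), hence
  `S_{j+1}/S_j = Q_j/P_{j+1}` for the `∂H`-modes `S = modeSum` (`modeSum_succ_div`, as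
  `α = cAlpha · S` with a face-type independent constant), and the corner dart ratio is
  `dart_{k_j+1}/dart_{k_j} = ω P_j/Q_j`, `ω = e^{2πi/3}` (`dart_corner_div`).

**Why.** Taking arguments (companion file): `cornerAngle_j = π/3 + arg Q_j - arg P_j` and
`arg(S_{j+1}/S_j) = arg Q_j - arg P_{j+1}` exactly, so the six corner angles at `x` sum to
`2π + Σ_j arg(S_{j+1}/S_j)`, and to `2π d`, `d ≥ 1` — the interior hexagon ledger S2 of the
combinatorial Gauss–Bonnet proof of `NoBranching` (stub report `STUB-REPORT-noBranching.md` §2).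

Sources: H. Duminil-Copin, S. Smirnov, *The connective constant of the honeycomb lattice equals
`√(2+√2)`*, Ann. of Math. 175 (2012) 1653–1665 (arXiv:1007.0575), Lemma 1 (through the affine
dictionary); the bookkeeping is elementary plane geometry of real-affine maps on the six triangles
around a vertex (folklore; e.g. the angle-sum/degree count for piecewise linear maps).
-/

noncomputable section

open Complex
open scoped ComplexConjugate
open Literature.Probability.LatticeModels Literature.Probability.RandomPlanarGeometry.SAW
open Literature.Barriers.CriticalPhenomena
open Summit.CriticalPhenomena.SAWScalingLimit.Theses.SAWDevelopingMap

namespace Summit.CriticalPhenomena.SAWScalingLimit.Cruxes.QCIdentification.EightFifthsPrimitive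

namespace NB

open Dev

/-! ### Combinatorics of the hexagon around a site -/

/-- The **corner index** of the `j`-th face around a site `x`: the corner of the triangle
`Δ_{face x j}` AT `x` is the one between the ports `cornerIdx j` and `cornerIdx j + 1`, i.e.
`triVert (face x j) (cornerIdx j + 1) = x` (`x`-independent). -/
def cornerIdx : Fin 6 → Fin 3 := ![1, 0, 2, 1, 0, 2]

/-- The six **spokes** of `𝕋` at a site, `e_l = ζ^l` (counterclockwise; the face `face x j` is
the sector between `e_j` and `e_{j+1}`). -/
def spoke (l : Fin 6) : ℂ := triZeta ^ (l : ℕ)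

/-- Spokes are non-zero. -/
theorem spoke_ne_zero (l : Fin 6) : spoke l ≠ 0 := by
  refine pow_ne_zero _ fun h => ?_
  have h6 := triZeta_pow_six
  rw [h] at h6
  norm_num at h6

/-- `‖conj e / e‖ = 1` for a spoke `e`. -/
theorem norm_conj_div_spoke (l : Fin 6) : ‖conj (spoke l) / spoke l‖ = 1 := by
  rw [norm_div, Complex.norm_conj, div_self (norm_ne_zero_iff.2 (spoke_ne_zero l))]

/-- Consecutive spokes differ by the rotation `ζ = e^{iπ/3}`. -/
theorem spoke_succ (j : Fin 6) : spoke (j + 1) = triZeta * spoke j := by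
  have h6 := triZeta_pow_six
  fin_cases j <;> simp [spoke, pow_succ, mul_comm]
  linear_combination -h6

/-- The corner of `face x j` at `x` is the vertex `triVert (face x j) (cornerIdx j + 1)`. -/
theorem triVert_face_cornerIdx (x : Site 2) (j : Fin 6) :
    triVert (HexKernel.face x j) (cornerIdx j + 1) = x := by
  fin_cases j <;> simp [HexKernel.face, HexKernel.unitE0, HexKernel.unitE1, cornerIdx, triVert]
  all_goals abel

/-- The port `cornerIdx j` of the `j`-th face leads to the `(j+1)`-st face. -/
theorem hexNbr_face_cornerIdx (x : Site 2) (j : Fin 6) :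
    hexNbr (HexKernel.face x j) (cornerIdx j) = HexKernel.face x (j + 1) := by
  fin_cases j <;> simp [HexKernel.face, HexKernel.unitE0, HexKernel.unitE1, cornerIdx, hexNbr]
  all_goals abel

/-- The port `cornerIdx (j+1) + 1` of the `(j+1)`-st face leads back to the `j`-th face. -/
theorem hexNbr_face_succ (x : Site 2) (j : Fin 6) :
    hexNbr (HexKernel.face x (j + 1)) (cornerIdx (j + 1) + 1) = HexKernel.face x j := by
  fin_cases j <;> simp [HexKernel.face, HexKernel.unitE0, HexKernel.unitE1, cornerIdx, hexNbr]
  all_goals abel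

/-- The outgoing edge of `Δ_{face x j}` at `x` is the spoke `e_j`. -/
theorem edge_out_eq_spoke (x : Site 2) (j : Fin 6) :
    triEmbed (triVert (HexKernel.face x j) (cornerIdx j + 1 + 1)) -
      triEmbed (triVert (HexKernel.face x j) (cornerIdx j + 1)) = spoke j := by
  rw [edge_eq]
  have h3 := triZeta_pow_three
  fin_cases j <;>
    simp [HexKernel.face, cornerIdx, faceSign, spoke, omg_eq_triZeta_sq, ← pow_mul]
  all_goals first
    | linear_combination (triZeta ^ 3 - 1) * h3
    | linear_combination (-triZeta) * h3
    | linear_combination (-triZeta ^ 3) * h3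
    | linear_combination (-triZeta ^ 2) * h3

/-- The incoming edge of `Δ_{face x j}` at `x` is minus the spoke `e_{j+1}`. -/
theorem edge_in_eq_neg_spoke (x : Site 2) (j : Fin 6) :
    triEmbed (triVert (HexKernel.face x j) (cornerIdx j + 1)) -
      triEmbed (triVert (HexKernel.face x j) (cornerIdx j)) = -spoke (j + 1) := by
  rw [edge_eq]
  have h3 := triZeta_pow_three
  fin_cases j <;>
    simp [HexKernel.face, cornerIdx, faceSign, spoke, omg_eq_triZeta_sq, ← pow_mul]
  all_goals first
    | linear_combination triZeta * h3
    | linear_combination triZeta ^ 3 * h3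
    | linear_combination triZeta ^ 2 * h3
    | linear_combination (triZeta ^ 3 - 1) * h3

/-! ### Darts across a shared mid-edge; the affine form of the darts -/

/-- **Darts across a shared mid-edge are opposite** (pure geometry, any mid-edge function: the
mid-edge point is the mean of the two centres). Registered form (∀-telescope). -/
theorem s2_dart_shared_neg : ∀ (F : Sym2 HexVertex → ℂ) (v : HexVertex) (k k' : Fin 3), hexNbr (hexNbr v k) k' = v → dart F (hexNbr v k) k' = -dart F v k := by
  intro F v k k' h
  simp only [dart]
  rw [h]
  have hs : s(hexNbr v k, v) = s(v, hexNbr v k) := Sym2.eq_swap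
  rw [hs, hexMidpoint_mk]
  ring

variable {Λ : Finset HexVertex} {a : Sym2 HexVertex}

/-- **Affine form of the darts**: `dart_k = α(v) Δz_k + β(v) conj Δz_k` along the `k`-th edge of
`Δ_v` (the affine dictionary `Dev.affine` read through a potential, which exists). -/
theorem dart_affine (hΛ : hexDomainSimplyConnected Λ) (ha : a ∈ hexDomainBoundary Λ)
    {v : HexVertex} (hv : v ∈ Λ) (k : Fin 3) :
    dart (Fobs Λ a) v k =
      alpha (Fobs Λ a) v * (triEmbed (triVert v (k + 1)) - triEmbed (triVert v k)) +
        beta (Fobs Λ a) v * conj (triEmbed (triVert v (k + 1)) - triEmbed (triVert v k)) := by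
  obtain ⟨H, hH⟩ := exists_isPotential hΛ ha
  rw [← affine hΛ ha hH hv k, increment hH hv k]
  rfl

/-! ### The Beltrami quotient and the two corner factors -/

/-- The **Beltrami quotient** `μ(v) = β(v)/α(v)` of the affine piece on `Δ_v`. -/
def mu (F : Sym2 HexVertex → ℂ) (v : HexVertex) : ℂ := beta F v / alpha F v

/-- The **first corner factor** of the `j`-th face at `x`: `P_j = 1 + μ_j conj(e_j)/e_j`, so
that the image of the spoke `e_j` computed in the face `j` is `α_j e_j P_j`. -/
def pfac (F : Sym2 HexVertex → ℂ) (x : Site 2) (j : Fin 6) : ℂ :=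
  1 + mu F (HexKernel.face x j) * (conj (spoke j) / spoke j)

/-- The **second corner factor** of the `j`-th face at `x`: `Q_j = 1 + μ_j conj(e_{j+1})/e_{j+1}`,
so that the image of the spoke `e_{j+1}` computed in the face `j` is `α_j e_{j+1} Q_j`. -/
def qfac (F : Sym2 HexVertex → ℂ) (x : Site 2) (j : Fin 6) : ℂ :=
  1 + mu F (HexKernel.face x j) * (conj (spoke (j + 1)) / spoke (j + 1))

/-- `Re(1 + μu) > 0` when `|μ| < 1 = |u|`. -/
theorem one_add_mul_re_pos {μ u : ℂ} (hμ : ‖μ‖ < 1) (hu : ‖u‖ = 1) :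
    0 < (1 + μ * u).re := by
  have h1 : |(μ * u).re| ≤ ‖μ * u‖ := Complex.abs_re_le_norm _
  rw [norm_mul, hu, mul_one] at h1
  have h2 := (abs_le.1 h1).1
  simp only [Complex.add_re, Complex.one_re]
  linarith

/-- `α(v) ≠ 0` at a non-degenerate face. -/
theorem alpha_ne_zero_of_modeSum {F : Sym2 HexVertex → ℂ} {v : HexVertex}
    (hS : modeSum F v ≠ 0) : alpha F v ≠ 0 :=
  fun h => hS ((alpha_eq_zero_iff F v).1 h)

/-- **(K) at a non-degenerate face**: `|μ(v)| < 1`. -/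
theorem norm_mu_lt_one (hK : NoFoldBound) (hΛ : hexDomainSimplyConnected Λ)
    (ha : a ∈ hexDomainBoundary Λ) {v : HexVertex} (hv : v ∈ Λ)
    (hS : modeSum (Fobs Λ a) v ≠ 0) : ‖mu (Fobs Λ a) v‖ < 1 := by
  obtain ⟨k, hk1, hk⟩ := noFoldBound_iff.1 hK
  rw [mu, norm_div, div_lt_one (norm_pos_iff.2 (alpha_ne_zero_of_modeSum hS))]
  exact norm_beta_lt hk1 hk hΛ ha hv hS

variable {x : Site 2}

/-- `Re P_j > 0`. -/
theorem pfac_re_pos (hK : NoFoldBound) (hΛ : hexDomainSimplyConnected Λ)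
    (ha : a ∈ hexDomainBoundary Λ) {j : Fin 6} (hv : HexKernel.face x j ∈ Λ)
    (hS : modeSum (Fobs Λ a) (HexKernel.face x j) ≠ 0) : 0 < (pfac (Fobs Λ a) x j).re :=
  one_add_mul_re_pos (norm_mu_lt_one hK hΛ ha hv hS) (norm_conj_div_spoke j)

/-- `Re Q_j > 0`. -/
theorem qfac_re_pos (hK : NoFoldBound) (hΛ : hexDomainSimplyConnected Λ)
    (ha : a ∈ hexDomainBoundary Λ) {j : Fin 6} (hv : HexKernel.face x j ∈ Λ)
    (hS : modeSum (Fobs Λ a) (HexKernel.face x j) ≠ 0) : 0 < (qfac (Fobs Λ a) x j).re :=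
  one_add_mul_re_pos (norm_mu_lt_one hK hΛ ha hv hS) (norm_conj_div_spoke (j + 1))

/-- **The outgoing dart at the corner**: `dart_{k_j + 1}(v_j) = α_j e_j P_j`. -/
theorem dart_out_eq (hΛ : hexDomainSimplyConnected Λ) (ha : a ∈ hexDomainBoundary Λ)
    (j : Fin 6) (hv : HexKernel.face x j ∈ Λ)
    (hS : modeSum (Fobs Λ a) (HexKernel.face x j) ≠ 0) :
    dart (Fobs Λ a) (HexKernel.face x j) (cornerIdx j + 1) =
      alpha (Fobs Λ a) (HexKernel.face x j) * spoke j * pfac (Fobs Λ a) x j := by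
  rw [dart_affine hΛ ha hv, edge_out_eq_spoke, pfac, mu]
  have hα := alpha_ne_zero_of_modeSum hS
  have hs := spoke_ne_zero j
  field_simp

/-- **The incoming dart at the corner**: `dart_{k_j}(v_j) = -α_j e_{j+1} Q_j`. -/
theorem dart_in_eq (hΛ : hexDomainSimplyConnected Λ) (ha : a ∈ hexDomainBoundary Λ)
    (j : Fin 6) (hv : HexKernel.face x j ∈ Λ)
    (hS : modeSum (Fobs Λ a) (HexKernel.face x j) ≠ 0) :
    dart (Fobs Λ a) (HexKernel.face x j) (cornerIdx j) =
      -(alpha (Fobs Λ a) (HexKernel.face x j) * spoke (j + 1) * qfac (Fobs Λ a) x j) := by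
  rw [dart_affine hΛ ha hv, edge_in_eq_neg_spoke, qfac, mu, map_neg]
  have hα := alpha_ne_zero_of_modeSum hS
  have hs := spoke_ne_zero (j + 1)
  field_simp
  ring

/-- **Matching across the shared spoke**: `α_{j+1} P_{j+1} = α_j Q_j` (the image of the spoke
`e_{j+1}` is the same vector whether computed in the face `j` or in the face `j+1`). -/
theorem alpha_succ_mul_pfac (hΛ : hexDomainSimplyConnected Λ) (ha : a ∈ hexDomainBoundary Λ)
    (j : Fin 6) (hv : HexKernel.face x j ∈ Λ) (hv' : HexKernel.face x (j + 1) ∈ Λ)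
    (hS : modeSum (Fobs Λ a) (HexKernel.face x j) ≠ 0)
    (hS' : modeSum (Fobs Λ a) (HexKernel.face x (j + 1)) ≠ 0) :
    alpha (Fobs Λ a) (HexKernel.face x (j + 1)) * pfac (Fobs Λ a) x (j + 1) =
      alpha (Fobs Λ a) (HexKernel.face x j) * qfac (Fobs Λ a) x j := by
  have h := s2_dart_shared_neg (Fobs Λ a) (HexKernel.face x j) (cornerIdx j)
    (cornerIdx (j + 1) + 1) (by rw [hexNbr_face_cornerIdx, hexNbr_face_succ])
  rw [hexNbr_face_cornerIdx, dart_out_eq hΛ ha (j + 1) hv' hS', dart_in_eq hΛ ha j hv hS,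
    neg_neg] at h
  apply mul_left_cancel₀ (spoke_ne_zero (j + 1))
  linear_combination h

/-- **The ratio of consecutive `∂H`-modes**: `S_{j+1}/S_j = Q_j/P_{j+1}`. -/
theorem modeSum_succ_div (hK : NoFoldBound) (hΛ : hexDomainSimplyConnected Λ)
    (ha : a ∈ hexDomainBoundary Λ) (j : Fin 6) (hv : HexKernel.face x j ∈ Λ)
    (hv' : HexKernel.face x (j + 1) ∈ Λ) (hS : modeSum (Fobs Λ a) (HexKernel.face x j) ≠ 0)
    (hS' : modeSum (Fobs Λ a) (HexKernel.face x (j + 1)) ≠ 0) :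
    modeSum (Fobs Λ a) (HexKernel.face x (j + 1)) / modeSum (Fobs Λ a) (HexKernel.face x j) =
      qfac (Fobs Λ a) x j / pfac (Fobs Λ a) x (j + 1) := by
  have h := alpha_succ_mul_pfac hΛ ha j hv hv' hS hS'
  simp only [alpha] at h
  rw [div_eq_div_iff hS (Complex.ne_zero_of_re_pos (pfac_re_pos hK hΛ ha hv' hS'))]
  apply mul_left_cancel₀ cAlpha_ne_zero
  linear_combination h

/-- **The ratio of the two darts at the corner**: `dart_{k_j+1}/dart_{k_j} = ω P_j/Q_j`
(`e_j / (-e_{j+1}) = -ζ⁻¹ = ζ² = ω`). -/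
theorem dart_corner_div (hK : NoFoldBound) (hΛ : hexDomainSimplyConnected Λ)
    (ha : a ∈ hexDomainBoundary Λ) (j : Fin 6) (hv : HexKernel.face x j ∈ Λ)
    (hS : modeSum (Fobs Λ a) (HexKernel.face x j) ≠ 0) :
    dart (Fobs Λ a) (HexKernel.face x j) (cornerIdx j + 1) /
        dart (Fobs Λ a) (HexKernel.face x j) (cornerIdx j) =
      omg * (pfac (Fobs Λ a) x j / qfac (Fobs Λ a) x j) := by
  have hα := alpha_ne_zero_of_modeSum hS
  have hQ := Complex.ne_zero_of_re_pos (qfac_re_pos hK hΛ ha hv hS)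
  have h3 := triZeta_pow_three
  rw [dart_out_eq hΛ ha j hv hS, dart_in_eq hΛ ha j hv hS,
    div_eq_iff (neg_ne_zero.2 (mul_ne_zero (mul_ne_zero hα (spoke_ne_zero (j + 1))) hQ)),
    spoke_succ, ← mul_div_assoc, div_mul_eq_mul_div, eq_div_iff hQ, omg_eq_triZeta_sq]
  linear_combination (alpha (Fobs Λ a) (HexKernel.face x j) * spoke j * pfac (Fobs Λ a) x j *
    qfac (Fobs Λ a) x j) * h3

end NB

end Summit.CriticalPhenomena.SAWScalingLimit.Cruxes.QCIdentification.EightFifthsPrimitive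

end
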